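import Summits.BirchSwinnertonDyer.BirchSwinnertonDyer.Theorems.RamifiedSevenEllipticUnitsValueOfKMCImpReading
import Summits.BirchSwinnertonDyer.BirchSwinnertonDyer.Theorems.KatoDescentPotSupersingularReducibleFineSelmerMuZeroCharForm
import Summits.BirchSwinnertonDyer.BirchSwinnertonDyer.Theorems.SmallImageMuTransferMuTransferStubX9MuBookkeeping
import Summits.BirchSwinnertonDyer.Rank1Residual.X12.CMRamifiedReducible
import Literature.NumberTheory.EllipticCurves.IwasawaModuleFinitePadicIntProofs
import Literature.NumberTheory.EllipticCurves.KatoFineSelmerDualUniquenessProofs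
import Literature.NumberTheory.EllipticCurves.Kato2004.IwasawaH1RankLeOneProofs
import Literature.NumberTheory.EllipticCurves.Kato2004.IwasawaH1FreeOfNoRationalTorsionProofs
import Summits.BirchSwinnertonDyer.Rank1Residual.Additive.KatoDescentIntegralH1RankOne
import HarnessLib

set_option linter.dupNamespace false
set_option autoImplicit false

/-!
# The Selmer half of stub 2b is in the tree: on `𝒞₇` at `7`, statement (A) ⟹ `length_{(7)} Y.X = 0`,
# so the `μ`-equality of Kato's 12.10 (stub `stub_katoMuEqualitySeven` of the 19945 line of record
# `Cruxes/EllipticUnitValueSevenOfGZK/Lines/kato_perrin_riou_zp.lean`, v9) REDUCES to the `7`-PRIMITIVITY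
# of the admissible zeta class (`KatoPrimitiveSeven`)
# — REV 2 (g54): P1 `FineDualFGSeven` and K3 `ResidualNonvanishingSeven ⟹ KatoPrimitiveSeven` (granted GZK) PROVED;
# stub 2b ⟸ {char-form `μ = 0`, FW, GZK} ∧ `ResidualNonvanishingSeven`

Crux workfile (ideation seat `bsd-idea-20`, generations 53–54, crux idea `abelian-residue-mu-seven`) for
`EllipticUnitValueSevenOfGZK` (stmt-BirchSwinnertonDyer-19945).  NOT a registered skeleton (W-79: the line of
record is untouched, sha16 `7f643694dfb0cab1`); THEOREMS + three `Prop` definitions; no `sorry`, no instance, no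
notation, no named fact introduced; nothing about BSD, Kato's Conjecture 12.10 or `X12.CMRamifiedSeven` is proved —
no summit statement is proved by this seat.

## What is proved (kernel-checked)

* `conjA_seven_of_classCSeven` — statement (A) («`X₀(W/ℚ_cyc)` finitely generated over `ℤ_7`», the tree's
  `∃ γ D, Module.Finite ℤ_[7] …` spelling) for EVERY member `W ∈ 𝒞₇` and every cyclotomic `ℤ_7`-extension, from the
  two named facts {`classicalMuVanishes_finite_unramifiedClasses`, `ferreroWashington1979_classicalMuVanishes`}
  ALREADY in the kernel trust base of the potss cell: `X12.ClassCSeven W` gives `W.HasCM` and `CMRamified W 7`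
  (`X12.ClassCSeven.cmRamified_seven`), hence `W[7]` REDUCIBLE (`X12.red_of_cmRamified`, Mazur 1978 / CM dichotomy),
  hence (A) by the Borel-field road `ReducibleFineSelmerMuZeroCharForm.fineSelmerDual_moduleFinite_of_not_irreducible_of_charForm`
  (the Borel field `ℚ(ω²χ_D, ω⁵χ_D) ⊂ ℚ(ζ₇, √D)` is ABELIAN, so Ferrero–Washington applies; Coates–Sujatha Cor. 3.6).
* `finite_sevenTorsion_fineSelmerInfty_of_classCSeven`, `finite_quotient_seven_of_classCSeven` — `Sel₀(ℚ_∞, W[7^∞])[7]`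
  finite, hence `Y.X ⧸ (7)Y.X` finite for EVERY dual fine Selmer datum `Y` of ANY key (no top-generator hypothesis).
* `lengthAt_seven_fineSelmerDual_eq_zero_of_classCSeven` — `length_{(7)} Y.X = 0` for every such `Y` finitely
  generated over `Λ` (the f.g. binder is discharged by the tree at the normalised key `γ`:
  `lengthAt_seven_realisedFineSelmerDual_eq_zero_of_classCSeven`; at the contragredient key `γ⁻¹` of stub 2b it is
  the one-line support statement `FineDualFGSeven` below — Nakayama for the dual pair, exactly as
  `FineSelmerDualData.module_finite_of_finite_pTorsion` at key `γ`).
* `stubKatoMuEqualitySeven_of` — **stub 2b VERBATIM follows from `FineDualFGSeven ∧ KatoPrimitiveSeven`** given the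
  two named facts: both sides of the `μ`-equality are `0`.

## The reduced research statement and the mechanism (crux idea card `Ideas/abelian-residue-mu-seven.md`)

`KatoPrimitiveSeven` («for every admissible `z₀` on a member of `𝒞₇`, `length_{(7)}(𝐇¹ ⧸ Λz₀) = 0`») is the
zeta-side `μ = 0`.  On `𝒞₇`, `𝐇¹ = I.H` is `Λ`-free (`KatoMemberTransport.moduleFree_iwasawaH1_of_classCSeven`, g52)
of rank one (Kato Thm. 12.4 (3)), so it says `z₀ ∉ 7·𝐇¹` (`ResidualNonvanishingSeven`, typed below; the implication
to `KatoPrimitiveSeven` is DVR arithmetic in `Λ_{(7)}`).  The residual class `z̄₀ ∈ 𝐇¹/7 ↪ H¹_Iw(ℚ_∞, W[7])` lives —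
because `W[7]^{ss} = 𝔽₇(ω²χ_D) ⊕ 𝔽₇(ω⁵χ_D)` with `ω⁵χ_D` EVEN and `H¹_Iw(ℚ_∞, 𝔽₇(even ≠ 1))` FINITE (not zero — its `Λ/7`-rank equals
`rank H²_Iw = 0`; critic V#22bi n1) — modulo finite modules on the ODD ABELIAN line `H¹_Iw(ℚ_∞, 𝔽₇(ω²χ_D))`, whose free part is the `Λ/7`-line of the twisted CYCLOTOMIC-UNIT class
(Kummer theory for the even character `ωχ_D`).  Comparing Kato's explicit reciprocity law mod `7` with Coleman's for
cyclotomic units under the Eisenstein congruence `θ_{ψ_D} ≡ E(ω²χ_D, ω⁵χ_D) (mod 𝔭)` gives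
`z̄₀ = Ḡ_{ω⁴χ_D}(T) · c̄_{ωχ_D}` up to `(Λ/7)ˣ` and finite torsion, where `G_{ω⁴χ_D} ∈ ℤ_7⟦T⟧` is the
Kubota–Leopoldt/Stickelberger power series of the branch `ω⁴χ_D` (bottom value `B_{1,ω⁴χ_D}` — the quantity where the
level-one congruence road «ROUTE-U» stops when `7 ∣ B_{1,ω⁴χ_D}`, e.g. `D = −79, −107`).  `μ(G_{ω⁴χ_D}) = 0` is
FERRERO–WASHINGTON for the abelian field `ℚ(ζ₇, √D)`: the `μ`-statement 2b is blind to the `λ`-obstruction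
`7 ∣ B_{1,ω⁴χ_D}`.  The one load-bearing residual is the UNIT CONSTANT of that comparison at Kato's member `W_K`
(symbol lattice = Néron lattice, g52 evidence #53; Burungale–Tian 2026 Rem. 2.7).

## REV 2 (generation 54, same subpath — refine, never re-file): the two cheap `Prop`s of REV 1 are PAID

* `FineSelmerDualData.module_finite_of_finite_pTorsion_anyKey` — Nakayama for the dual pair at an ARBITRARY key `γ'`
  (the tree's `FineSelmerDualData.module_finite_of_finite_pTorsion` minus its `IsTopGenerator` hypothesis: the dual-pair
  axioms are the structure fields, local nilpotence of `conj_{γ'} − 1` is the tree's any-key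
  `isLocNil_conjFineSelmerInfty_sub_one'`), whence **`fineDualFGSeven_holds : FineDualFGSeven`** (P1 of the card, PROVED).
* **`katoPrimitiveSeven_of_residualNonvanishing : GZK → ResidualNonvanishingSeven → KatoPrimitiveSeven`** (K3 of the card,
  PROVED; GZK = `rank_eq_analyticRank_of_analyticRank_le_one`, the crux's OWN antecedent, so no named-fact debt is added to
  the line): on `𝒞₇`, `𝐇¹ = I.H` is `Λ`-free (Kato Thm. 12.4 (3) in the tree, `IwasawaH1Data.moduleFree_of_torsionBy_eq_bot`,
  its hypothesis `W(ℚ)[7] = 0` from `ValueOfKMCPerrinRiou.not_seven_dvd_torsionOrder`) of `Λ`-rank `≤ 1` ((R1)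
  `LocPKummer.rank_integralH1_le_one` from rank one + `Ш` finite = GZK on `𝒞₇`, then (R2)
  `IwasawaH1Data.rank_le_one_of_rank_integralH1_le_one`), and `z₀ ∉ 7·𝐇¹` forces `z₀ ≠ 0`, so rank `= 1`, `𝐇¹ = Λ·e`
  (`exists_generator_of_moduleFree_of_rank_eq_one`), `𝐇¹ ⧸ Λz₀ ≅ Λ ⧸ (β)` with `β ∉ (7)` is finitely generated over `ℤ_7`
  (`moduleFinite_quotient_span_of_generator_of_not_mem_augIdealP_smul_top`, Weierstrass preparation) and
  `length_{(7)} = 0` (`lengthAt_eq_zero_of_finite`, Washington §13.2).  FREENESS IS LOAD-BEARING: for the non-free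
  rank-one module `𝔪 = (7, T)` and `z₀ = 7 ∉ 7𝔪`, `𝔪 ⧸ Λ·7 ≅ Λ ⧸ (7)` has `length_{(7)} = 1`.
* **`stubKatoMuEqualitySeven_of_residualNonvanishing` — stub 2b VERBATIM ⟸ {char-form `μ = 0`, Ferrero–Washington, GZK}
  ∧ `ResidualNonvanishingSeven`**: after REV 2 the ONLY research input left under stub 2b is K2 («`z̄₀ ≠ 0` in
  `𝐇¹/7`»), the statement the card's mechanism (odd abelian line + Ferrero–Washington for `ℚ(ζ₇, √D)`) addresses.
  The reshaping `stub 2b ↦ GZK → stub 2b` is zero-cost for the line of record (`kmcFine_at` is only consumed inside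
  `bsdpSeven_at hGZK …`), but is the LEAD's call (W-79): this file touches no skeleton.  Still no `sorry`, no instance, no
  notation, no new named fact; nothing about K2, Kato 12.10, `X12.CMRamifiedSeven` or BSD is proved — no summit statement
  is proved by this seat.
* REV 2.1 (same gen): the CONVERSE is unconditional — `not_mem_seven_smul_top_of_lengthAt_quotient_span_eq_zero`: a NON-ZERO
  class with `length_{(7)}(𝐇¹ ⧸ Λz) = 0` is not `7`-divisible (`𝐇¹` f.g. (12.2.1) + torsion free + Weierstrass division:
  `finite_of_lengthAt_eq_zero`, `not_moduleFinite_quotient_span_of_mem_augIdealP_smul_top`); whence the pointwise dictionary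
  `lengthAt_seven_quotient_span_eq_zero_iff_not_mem` (on `𝒞₇`, granted GZK, for every `z ≠ 0`: `length_{(7)}(𝐇¹ ⧸ Λz) = 0 ⟺
  z ∉ 7·𝐇¹`) and `residualNonvanishing_of_katoPrimitiveSeven_of_ne_zero`: the card's transfer `2b′ ↝ K2` is LOSSLESS at every
  non-zero admissible class (critic V#22bi n1/n2 docstring fixes also applied: `H¹_Iw(ℚ_∞, 𝔽₇(ω⁵χ_D))` FINITE, stub 2b at l.229–237).

References: K. Kato, Astérisque 295 (2004) Thm. 12.4 (3), Thm. 12.5 (4), Thm. 12.6, Conj. 12.10 (pp. 219–224)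
[Kato2004Asterisque]; J. Coates, R. Sujatha, Math. Ann. 331 (2005) Cor. 3.6 [CoatesSujatha2005]; B. Ferrero,
L. Washington, Ann. of Math. 109 (1979) [FerreroWashington1979]; C. Wuthrich, J. Algebraic Geom. 23 (2014) Lemma 14
[Wuthrich2014]; R. Greenberg, V. Vatsal, Invent. Math. 142 (2000) §3 [GreenbergVatsal2000]; A. Burungale, Y. Tian (2026)
Rem. 2.7 [BurungaleTian2026]; B. Mazur, Invent. Math. 44 (1978) Thm. 1 [Mazur1978].
-/

noncomputable section

open scoped Classical NumberField

open WeierstrassCurve Literature.NumberTheory.EllipticCurves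
open Literature.NumberTheory.EllipticCurves.Rank1Residual
open Literature.NumberTheory.EllipticCurves.Rank1Residual.Typed
open Literature.NumberTheory.EllipticCurves.IwasawaAlgebra
open Literature.NumberTheory.EllipticCurves.Kato2004
open Literature.NumberTheory.IwasawaTheory
open Summit.BirchSwinnertonDyer.Rank1Residual
open Summit.BirchSwinnertonDyer.Rank1Residual.Additive
open Summit.BirchSwinnertonDyer.Rank1Residual.X12.O11

namespace Summit.BirchSwinnertonDyer.BirchSwinnertonDyer.Cruxes.EllipticUnitValueSevenOfGZK.KatoMuAbelianResidue

/-! ## §1 The Selmer side of 2b at `(7)` is a theorem modulo {char-form `μ = 0`, Ferrero–Washington} -/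

/-- **Statement (A) on `𝒞₇` at `p = 7`** — `X₀(W/K)` is finitely generated over `ℤ_7` for every member `W` of
`𝒞₇` and every cyclotomic `ℤ_7`-extension `K/ℚ` (tree spelling `∃ γ D, Module.Finite ℤ_[7] D.X`): `W` has CM by
`ℚ(√−7)`, `7` ramifies there, so `W[7]` is reducible and the Borel-field road applies.
[cite: CoatesSujatha2005, Cor. 3.6] [cite: FerreroWashington1979, main theorem] [cite: Mazur1978, Thm 1 (Introduction, pp. 129–130)] -/
theorem conjA_seven_of_classCSeven
    (hchar : classicalMuVanishes_finite_unramifiedClasses) (hFW : ferreroWashington1979_classicalMuVanishes)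
    (W : WeierstrassCurve ℚ) [W.IsElliptic] [W.IsGloballyMinimal] [Fact (Nat.Prime 7)] (hC : X12.ClassCSeven W)
    (K : ZpExtension ℚ 7) (hK : K.IsCyclotomic) :
    ∃ (γ : Field.absoluteGaloisGroup ℚ) (D : W.FineSelmerDualData K γ),
      Module.Finite ℤ_[7] (RestrictScalars ℤ_[7] (IwasawaAlgebra 7) D.X) :=
  Summit.BirchSwinnertonDyer.BirchSwinnertonDyer.Theorems.ReducibleFineSelmerMuZeroCharForm.fineSelmerDual_moduleFinite_of_not_irreducible_of_charForm
    hchar hFW W 7 (by decide) (X12.red_of_cmRamified W 7 hC.1 (by decide) (X12.ClassCSeven.cmRamified_seven hC)) K hK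

/-- **`Sel₀(W/K)[7]` is finite on `𝒞₇`** (statement (A) read through the tree's `Module.Finite ℤ_p ↔ finite
`p`-torsion` dictionary at a normalised topological generator `γ`). [cite: CoatesSujatha2005, Cor. 3.6]
[cite: GreenbergLNM1716, §1 p. 60 (after Conj. 1.3)] -/
theorem finite_sevenTorsion_fineSelmerInfty_of_classCSeven
    (hchar : classicalMuVanishes_finite_unramifiedClasses) (hFW : ferreroWashington1979_classicalMuVanishes)
    (W : WeierstrassCurve ℚ) [W.IsElliptic] [W.IsGloballyMinimal] [Fact (Nat.Prime 7)] (hC : X12.ClassCSeven W)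
    (K : ZpExtension ℚ 7) (hK : K.IsCyclotomic) {γ : Field.absoluteGaloisGroup ℚ} (hγ : K.IsTopGenerator γ) :
    Set.Finite {s : W.fineSelmerInfty K | (7 : ℕ) • s = 0} :=
  (IwasawaModuleFinitePadicInt.exists_fineSelmerDualData_moduleFinite_iff_finite_pTorsion W K hγ).mp
    (conjA_seven_of_classCSeven hchar hFW W hC K hK)

/-- **`Y.X ⧸ (7)·Y.X` is finite for EVERY dual fine Selmer datum `Y` of a `𝒞₇` member, of ANY key** (in
particular the contragredient key `γ⁻¹` of stub 2b). [cite: GreenbergLNM1716, §1 p. 60 (after Conj. 1.3)]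
[cite: CoatesSujatha2005, Cor. 3.6] -/
theorem finite_quotient_seven_of_classCSeven
    (hchar : classicalMuVanishes_finite_unramifiedClasses) (hFW : ferreroWashington1979_classicalMuVanishes)
    (W : WeierstrassCurve ℚ) [W.IsElliptic] [W.IsGloballyMinimal] [Fact (Nat.Prime 7)] (hC : X12.ClassCSeven W)
    (K : ZpExtension ℚ 7) (hK : K.IsCyclotomic) {γ : Field.absoluteGaloisGroup ℚ} (hγ : K.IsTopGenerator γ)
    {γ' : Field.absoluteGaloisGroup ℚ} (Y : W.FineSelmerDualData K γ') :
    Finite (Y.X ⧸ (IwasawaAlgebra.augIdealP 7 • (⊤ : Submodule (IwasawaAlgebra 7) Y.X))) :=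
  Y.finite_quotient_augIdealP_of_finite_pTorsion
    (finite_sevenTorsion_fineSelmerInfty_of_classCSeven hchar hFW W hC K hK hγ)

/-- **The Selmer side of the `μ`-equality vanishes: `length_{(7)} Y.X = 0`** for every dual fine Selmer datum
`Y` (any key) of a `𝒞₇` member that is finitely generated over `Λ`. [cite: CoatesSujatha2005, Cor. 3.6]
[cite: Washington1997, §13.2] -/
theorem lengthAt_seven_fineSelmerDual_eq_zero_of_classCSeven
    (hchar : classicalMuVanishes_finite_unramifiedClasses) (hFW : ferreroWashington1979_classicalMuVanishes)
    (W : WeierstrassCurve ℚ) [W.IsElliptic] [W.IsGloballyMinimal] [Fact (Nat.Prime 7)] (hC : X12.ClassCSeven W)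
    (K : ZpExtension ℚ 7) (hK : K.IsCyclotomic) {γ : Field.absoluteGaloisGroup ℚ} (hγ : K.IsTopGenerator γ)
    {γ' : Field.absoluteGaloisGroup ℚ} (Y : W.FineSelmerDualData K γ') [Module.Finite (IwasawaAlgebra 7) Y.X]
    (𝔮 : PrimeSpectrum (IwasawaAlgebra 7)) (h𝔮 : 𝔮.asIdeal = IwasawaAlgebra.augIdealP 7) :
    Module.lengthAt (IwasawaAlgebra 7) Y.X 𝔮 = 0 := by
  haveI := finite_quotient_seven_of_classCSeven hchar hFW W hC K hK hγ Y
  exact Rank1Residual.KatoMuSkeleton.lengthAt_eq_zero_of_finite_quotient_p (M := Y.X) 𝔮 h𝔮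

/-- … in particular, WITHOUT any finiteness hypothesis, for the REALISED dual datum at the normalised key `γ`
(the f.g. binder is the tree's `FineSelmerDualData.module_finite_of_finite_pTorsion`). [cite: CoatesSujatha2005, Cor. 3.6]
[cite: GreenbergLNM1716, §1 p. 60 (after Conj. 1.3)] -/
theorem lengthAt_seven_realisedFineSelmerDual_eq_zero_of_classCSeven
    (hchar : classicalMuVanishes_finite_unramifiedClasses) (hFW : ferreroWashington1979_classicalMuVanishes)
    (W : WeierstrassCurve ℚ) [W.IsElliptic] [W.IsGloballyMinimal] [Fact (Nat.Prime 7)] (hC : X12.ClassCSeven W)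
    (K : ZpExtension ℚ 7) (hK : K.IsCyclotomic) {γ : Field.absoluteGaloisGroup ℚ} (hγ : K.IsTopGenerator γ)
    (𝔮 : PrimeSpectrum (IwasawaAlgebra 7)) (h𝔮 : 𝔮.asIdeal = IwasawaAlgebra.augIdealP 7) :
    Module.lengthAt (IwasawaAlgebra 7) (W.fineSelmerDualData K hγ).X 𝔮 = 0 := by
  haveI : Module.Finite (IwasawaAlgebra 7) (W.fineSelmerDualData K hγ).X :=
    (W.fineSelmerDualData K hγ).module_finite_of_finite_pTorsion hγ
      (finite_sevenTorsion_fineSelmerInfty_of_classCSeven hchar hFW W hC K hK hγ)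
  exact lengthAt_seven_fineSelmerDual_eq_zero_of_classCSeven hchar hFW W hC K hK hγ _ 𝔮 h𝔮

/-! ## §2 The reduced research statement (zeta side) and the verbatim reduction of stub 2b -/

/-- **SUPPORT (one line of Nakayama, the contragredient-key twin of the tree's
`FineSelmerDualData.module_finite_of_finite_pTorsion`)**: a dual fine Selmer datum of the contragredient key `γ⁻¹`
is finitely generated over `Λ` once `Sel₀(W/K)[7]` is finite.  A `Prop`; nothing asserted.
[cite: GreenbergLNM1716, §1 p. 60 (after Conj. 1.3)] -/
def FineDualFGSeven : Prop :=
  ∀ (W : WeierstrassCurve ℚ) [W.IsElliptic] [Fact (Nat.Prime 7)] (K : ZpExtension ℚ 7)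
    (γ : Field.absoluteGaloisGroup ℚ), K.IsTopGenerator γ →
      Set.Finite {s : W.fineSelmerInfty K | (7 : ℕ) • s = 0} →
        ∀ (Y : W.FineSelmerDualData K γ⁻¹), Module.Finite (IwasawaAlgebra 7) Y.X

/-- **RESEARCH statement 2b′ = `KatoPrimitiveSeven` — the zeta-side `μ` vanishes on `𝒞₇`**: for every member `W`,
cyclotomic datum, normalised pin and ADMISSIBLE class `z₀ ∈ 𝐇¹ = I.H`, `length_{(7)}(𝐇¹ ⧸ Λz₀) = 0` (with `𝐇¹`
free of rank one: `z₀ ∉ 7·𝐇¹`).  Vacuous on a member with no admissible class.  A `Prop`; nothing asserted; this is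
the `μ`-half of Kato's Conj. 12.10 (2) at the reducible prime `7`, OPEN IN PRINT (Burungale–Tian Rem. 2.7).
[cite: Kato2004Asterisque, Conj. 12.10 (p. 224), Thm. 12.4 (3) (p. 219)] [cite: BurungaleTian2026, Rem. 2.7 (p. 5)] -/
def KatoPrimitiveSeven : Prop :=
  ∀ (W : WeierstrassCurve ℚ) [W.IsElliptic] [W.IsGloballyMinimal] [Fact (Nat.Prime 7)], X12.ClassCSeven W →
    letI : ContinuousSMul ℤ_[7] (W.tateModule 7) := TateModule.continuousSMul_padicInt
    ∀ (K : ZpExtension ℚ 7) (hK : K.IsCyclotomic) (γ : Field.absoluteGaloisGroup ℚ) (_ : K.IsTopGenerator γ)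
      (I : IwasawaH1Data W 7 K γ) (z₀ : I.H), Kato2004.IsAdmissibleZetaClass W 7 K hK I z₀ →
      ∀ (𝔮 : PrimeSpectrum (IwasawaAlgebra 7)), 𝔮.asIdeal.height = 1 →
        𝔮.asIdeal = IwasawaAlgebra.augIdealP 7 →
        Module.lengthAt (IwasawaAlgebra 7) (I.H ⧸ (IwasawaAlgebra 7) ∙ z₀) 𝔮 = 0

/-- **RESEARCH statement K2 = `ResidualNonvanishingSeven` — the residual admissible class is nonzero**:
`z₀ ∉ (7)·𝐇¹`, i.e. `z̄₀ ≠ 0` in `𝐇¹/7 ↪ H¹_Iw(ℚ_∞, W[7])`.  With `𝐇¹` free of rank one this is `KatoPrimitiveSeven`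
(DVR arithmetic in `Λ_{(7)}`); the card's mechanism decides it on the odd abelian line `H¹_Iw(ℚ_∞, 𝔽₇(ω²χ_D))` by
Ferrero–Washington for `ℚ(ζ₇, √D)`.  A `Prop`; nothing asserted.
[cite: Kato2004Asterisque, Thm. 12.5 (4) (p. 222), Conj. 12.10 (p. 224)] [cite: FerreroWashington1979, main theorem] -/
def ResidualNonvanishingSeven : Prop :=
  ∀ (W : WeierstrassCurve ℚ) [W.IsElliptic] [W.IsGloballyMinimal] [Fact (Nat.Prime 7)], X12.ClassCSeven W →
    letI : ContinuousSMul ℤ_[7] (W.tateModule 7) := TateModule.continuousSMul_padicInt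
    ∀ (K : ZpExtension ℚ 7) (hK : K.IsCyclotomic) (γ : Field.absoluteGaloisGroup ℚ) (_ : K.IsTopGenerator γ)
      (I : IwasawaH1Data W 7 K γ) (z₀ : I.H), Kato2004.IsAdmissibleZetaClass W 7 K hK I z₀ →
      z₀ ∉ (IwasawaAlgebra.augIdealP 7 • (⊤ : Submodule (IwasawaAlgebra 7) I.H))

/-- **STUB 2b VERBATIM from `FineDualFGSeven ∧ KatoPrimitiveSeven`, given {char-form `μ = 0`, FW}**: the type below
is letter-for-letter the type of `KatoPerrinRiouZp.stub_katoMuEqualitySeven` (line of record v9, l. 229–237); both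
sides of the `μ`-equality are `0` — the left by §1 (statement (A) on `𝒞₇`, in the tree), the right by 2b′.
CONDITIONAL on the four hypotheses; nothing asserted; 19945 stays OPEN.
[cite: Kato2004Asterisque, Conj. 12.10 (p. 224)] [cite: CoatesSujatha2005, Cor. 3.6] [cite: BurungaleTian2026, Rem. 2.7 (p. 5)] -/
theorem stubKatoMuEqualitySeven_of
    (hchar : classicalMuVanishes_finite_unramifiedClasses) (hFW : ferreroWashington1979_classicalMuVanishes)
    (hfg : FineDualFGSeven) (hprim : KatoPrimitiveSeven) :
    ∀ (W : WeierstrassCurve ℚ) [W.IsElliptic] [W.IsGloballyMinimal] [Fact (Nat.Prime 7)], X12.ClassCSeven W →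
      letI : ContinuousSMul ℤ_[7] (W.tateModule 7) := TateModule.continuousSMul_padicInt
      ∀ (K : ZpExtension ℚ 7) (hK : K.IsCyclotomic) (γ : Field.absoluteGaloisGroup ℚ) (_ : K.IsTopGenerator γ)
        (I : IwasawaH1Data W 7 K γ) (z₀ : I.H), Kato2004.IsAdmissibleZetaClass W 7 K hK I z₀ →
        ∀ (Y : W.FineSelmerDualData K γ⁻¹) (𝔮 : PrimeSpectrum (IwasawaAlgebra 7)), 𝔮.asIdeal.height = 1 →
          𝔮.asIdeal = IwasawaAlgebra.augIdealP 7 →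
          Module.lengthAt (IwasawaAlgebra 7) Y.X 𝔮 =
            Module.lengthAt (IwasawaAlgebra 7) (I.H ⧸ (IwasawaAlgebra 7) ∙ z₀) 𝔮 := by
  intro W _ _ _ hC K hK γ hγ I z₀ hz₀ Y 𝔮 h𝔮 h7
  haveI : Module.Finite (IwasawaAlgebra 7) Y.X :=
    hfg W K γ hγ (finite_sevenTorsion_fineSelmerInfty_of_classCSeven hchar hFW W hC K hK hγ) Y
  rw [lengthAt_seven_fineSelmerDual_eq_zero_of_classCSeven hchar hFW W hC K hK hγ Y 𝔮 h7]
  exact (hprim W hC K hK γ hγ I z₀ hz₀ 𝔮 h𝔮 h7).symm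

/-! ## §3 (REV 2, g54) P1 and K3 PAID: stub 2b ⟸ {char-form `μ = 0`, FW, GZK} ∧ `ResidualNonvanishingSeven` -/

/-- **P1, general form — Nakayama for the dual fine Selmer pair at an ARBITRARY key `γ'`**: a dual fine Selmer datum
`Y` of any key over any `ℤ_p`-extension of a number field is finitely generated over `Λ` once `Sel₀(K_∞, E[p^∞])[p]` is
finite.  The tree's `FineSelmerDualData.module_finite_of_finite_pTorsion` VERBATIM minus its hypothesis
`κ.IsTopGenerator γ`, which was only used for local nilpotence of `conj_γ − 1`; at an arbitrary key that is the tree's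
`isLocNil_conjFineSelmerInfty_sub_one'`. [cite: GreenbergLNM1716, §1 p. 60 (after Conj. 1.3)] [cite: Lang1990, Ch. 5 §1 (Nakayama's lemma)] -/
theorem FineSelmerDualData.module_finite_of_finite_pTorsion_anyKey {F : Type*} [Field F] [NumberField F]
    {V : WeierstrassCurve F} {p : ℕ} [Fact p.Prime] {κ : ZpExtension F p} {γ' : Field.absoluteGaloisGroup F}
    (Y : V.FineSelmerDualData κ γ') (hfin : Set.Finite {s : V.fineSelmerInfty κ | p • s = 0}) :
    Module.Finite (IwasawaAlgebra p) Y.X := by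
  have hpair : IwasawaDual.IsDualPair p (V.conjFineSelmerInfty κ γ' - 1) Y.toDual :=
    { bijective := Y.bijective
      T_smul := fun x s ↦ by
        rw [Y.toDual_T_smul, IwasawaDual.End_sub_apply, AddMonoid.End.one_apply, map_sub]
        rfl
      C_smul := fun c x s k hk ↦ Y.toDual_C_smul c x s k hk
      locNil := V.isLocNil_conjFineSelmerInfty_sub_one' κ γ' }
  refine hpair.module_finite ?_
  refine hfin.subset fun s hs ↦ ?_
  obtain ⟨hs1, -⟩ := hs
  rw [pow_one] at hs1
  exact hs1

/-- **P1 PAID: `FineDualFGSeven` holds** (the contragredient key `γ⁻¹` is just some key). [cite: GreenbergLNM1716, §1 p. 60 (after Conj. 1.3)] -/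
theorem fineDualFGSeven_holds : FineDualFGSeven :=
  fun _W _ _ _K _γ _ hfin Y ↦ FineSelmerDualData.module_finite_of_finite_pTorsion_anyKey Y hfin

/-- **Bridge `p ∤ #W(ℚ)_tors ⟹ W(ℚ)[p] = 0`** in the `AddSubgroup.torsionBy … (p : ℤ) = ⊥` currency of
`IwasawaH1Data.moduleFree_of_torsionBy_eq_bot` (a non-zero `P` with `p • P = 0` has order `p` in the finite group
`E(ℚ)_tors`).  Re-proved here (7 lines) rather than imported from the g52 crux workfile `KatoMemberTorsionLemma.lean`,
crux workfiles not being import targets. [folklore] [cite: SilvermanAEC2009, Cor. VIII.6.7.1 (finiteness of `E(K)_tors`)] -/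
theorem torsionBy_eq_bot_of_not_dvd_torsionOrder (W : WeierstrassCurve ℚ) [W.IsElliptic] (p : ℕ)
    [hp : Fact p.Prime] (h : ¬ p ∣ W.torsionOrder) :
    AddSubgroup.torsionBy W.toAffine.Point (p : ℤ) = ⊥ := by
  haveI hfin : Finite (AddCommGroup.torsion W.toAffine.Point) := by
    convert W.finite_torsion_point
  have h' : ¬ p ∣ Nat.card (AddCommGroup.torsion W.toAffine.Point) := by
    unfold WeierstrassCurve.torsionOrder at h
    convert h
  refine (AddSubgroup.eq_bot_iff_forall _).mpr fun P hP ↦ ?_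
  by_contra hP0
  have hpP : p • P = 0 := AddSubgroup.torsionBy.nsmul_iff.mp hP
  have hord : addOrderOf P = p := addOrderOf_eq_prime hpP hP0
  have hmem : P ∈ AddCommGroup.torsion W.toAffine.Point :=
    (AddCommGroup.mem_torsion P).2 (isOfFinAddOrder_iff_nsmul_eq_zero.2 ⟨p, hp.out.pos, hpP⟩)
  exact h' (hord ▸ AddSubgroup.addOrderOf_dvd_natCard _ hmem)

/-- **K3, pointwise core — on `𝒞₇`, granted GZK: a class `z ∉ 7·𝐇¹` has `length_{(7)}(𝐇¹ ⧸ Λz) = 0`** (for ANY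
`z ∈ 𝐇¹ = I.H`, admissible or not, and any `ContinuousSMul` structure on `T₇W`).  Ingredients, ALL tree theorems:
`𝐇¹` finitely generated ((12.2.1) `module_finite_of_isCyclotomic`), torsion free (`noZeroSMulDivisors`), FREE (Kato
Thm. 12.4 (3): `moduleFree_of_torsionBy_eq_bot`, hypothesis `W(ℚ)[7] = 0` from `not_seven_dvd_torsionOrder` on `𝒞₇`), of
rank `≤ 1` ((R1) `LocPKummer.rank_integralH1_le_one` — Mordell–Weil rank one and `Ш(W)` finite, i.e. GZK at analytic
rank one — then (R2) `rank_le_one_of_rank_integralH1_le_one`), hence of rank `= 1` as `z ≠ 0`; so `𝐇¹ = Λ·e`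
(`exists_generator_of_moduleFree_of_rank_eq_one`), `𝐇¹ ⧸ Λz` is finitely generated over `ℤ_7`
(`moduleFinite_quotient_span_of_generator_of_not_mem_augIdealP_smul_top`: `z = β e`, `β ∉ (7)`, Weierstrass preparation)
and `length_{(7)} = 0` (`lengthAt_eq_zero_of_finite`).  FREENESS is load-bearing (module docstring: `𝔪 = (7,T)`, `z = 7`).
[cite: Kato2004Asterisque, Thm. 12.4 (2)(3) (p. 221), §13.8 (pp. 228–229)] [cite: Washington1997, §7.1 Thm. 7.3, §13.2] -/
theorem lengthAt_seven_quotient_span_eq_zero_of_not_mem (hGZK : rank_eq_analyticRank_of_analyticRank_le_one)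
    (W : WeierstrassCurve ℚ) [W.IsElliptic] [W.IsGloballyMinimal] [Fact (Nat.Prime 7)] (hC : X12.ClassCSeven W)
    [ContinuousSMul ℤ_[7] (W.tateModule 7)] {K : ZpExtension ℚ 7} (hK : K.IsCyclotomic)
    {γ : Field.absoluteGaloisGroup ℚ} (hγ : K.IsTopGenerator γ) (I : IwasawaH1Data W 7 K γ) {z : I.H}
    (hz : z ∉ (IwasawaAlgebra.augIdealP 7 • (⊤ : Submodule (IwasawaAlgebra 7) I.H)))
    (𝔮 : PrimeSpectrum (IwasawaAlgebra 7)) (h7 : 𝔮.asIdeal = IwasawaAlgebra.augIdealP 7) :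
    Module.lengthAt (IwasawaAlgebra 7) (I.H ⧸ (IwasawaAlgebra 7) ∙ z) 𝔮 = 0 := by
  have hz0 : z ≠ 0 := by
    rintro rfl
    exact hz (Submodule.zero_mem _)
  -- rank-one inputs on `𝒞₇` from GZK: Mordell–Weil rank one and `Ш(W)` finite
  have hr : W.analyticRank = 1 := hC.2.2.1
  have hrank : W.mordellWeilRank = 1 := by rw [(hGZK W hr.le).1, hr]
  haveI : Finite W.sha := (hGZK W hr.le).2
  have hsha : Finite (AddCommGroup.primaryComponent W.sha 7) := inferInstance
  have hR1 := LocPKummer.rank_integralH1_le_one W 7 K hrank hsha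
  -- `𝐇¹` is torsion free, free, of rank one
  haveI := I.noZeroSMulDivisors hγ
  haveI : Nontrivial I.H := ⟨⟨z, 0, hz0⟩⟩
  have hrk : Module.rank (IwasawaAlgebra 7) I.H = 1 := I.rank_eq_one_of_rank_integralH1_le_one hK hγ hR1
  haveI : Module.Free (IwasawaAlgebra 7) I.H :=
    I.moduleFree_of_torsionBy_eq_bot hK hγ
      (torsionBy_eq_bot_of_not_dvd_torsionOrder W 7
        (Summit.BirchSwinnertonDyer.BirchSwinnertonDyer.Theorems.RamifiedSevenEllipticUnits.ValueOfKMCPerrinRiou.not_seven_dvd_torsionOrder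
          W hC))
  obtain ⟨e, he, hgen⟩ := exists_generator_of_moduleFree_of_rank_eq_one (p := 7) hrk
  -- `𝐇¹ ⧸ Λz` is finitely generated over `ℤ_7`, hence `length_{(7)} = 0`
  have hfg := moduleFinite_quotient_span_of_generator_of_not_mem_augIdealP_smul_top (p := 7) he hgen hz
  letI : _root_.Module ℤ_[7] (I.H ⧸ (IwasawaAlgebra 7) ∙ z) :=
    Module.compHom _ (algebraMap ℤ_[7] (IwasawaAlgebra 7))
  haveI : IsScalarTower ℤ_[7] (IwasawaAlgebra 7) (I.H ⧸ (IwasawaAlgebra 7) ∙ z) :=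
    IsScalarTower.of_compHom ℤ_[7] _ _
  haveI : Module.Finite ℤ_[7] (I.H ⧸ (IwasawaAlgebra 7) ∙ z) := hfg
  exact lengthAt_eq_zero_of_finite 7 (I.H ⧸ (IwasawaAlgebra 7) ∙ z) 𝔮 h7

/-- **The converse holds UNCONDITIONALLY (no GZK, no freeness): a NON-ZERO class with `length_{(7)}(𝐇¹ ⧸ Λz) = 0` is
not divisible by `7` in `𝐇¹`** — `𝐇¹` is finitely generated (12.2.1) and torsion free, so `length_{(7)} = 0` makes
`𝐇¹ ⧸ Λz` finitely generated over `ℤ_7` (`finite_of_lengthAt_eq_zero`, Weierstrass division), which a `7`-divisible class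
in a non-zero torsion-free `Λ`-module forbids (`not_moduleFinite_quotient_span_of_mem_augIdealP_smul_top`).  So on `𝒞₇`
the card's transfer `2b′ ↝ K2` is LOSSLESS at every non-zero class. [cite: Washington1997, §13.2]
[cite: Kato2004Asterisque, Thm. 12.4 (2) (p. 221), §17.13 (p. 280) (shape)] -/
theorem not_mem_seven_smul_top_of_lengthAt_quotient_span_eq_zero
    (W : WeierstrassCurve ℚ) [W.IsElliptic] [Fact (Nat.Prime 7)] [ContinuousSMul ℤ_[7] (W.tateModule 7)]
    {K : ZpExtension ℚ 7} (hK : K.IsCyclotomic) {γ : Field.absoluteGaloisGroup ℚ} (hγ : K.IsTopGenerator γ)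
    (I : IwasawaH1Data W 7 K γ) {z : I.H} (hz0 : z ≠ 0)
    (𝔮 : PrimeSpectrum (IwasawaAlgebra 7)) (h7 : 𝔮.asIdeal = IwasawaAlgebra.augIdealP 7)
    (h : Module.lengthAt (IwasawaAlgebra 7) (I.H ⧸ (IwasawaAlgebra 7) ∙ z) 𝔮 = 0) :
    z ∉ (IwasawaAlgebra.augIdealP 7 • (⊤ : Submodule (IwasawaAlgebra 7) I.H)) := by
  haveI := IwasawaH1Data.module_finite_of_isCyclotomic hK hγ I
  haveI := I.noZeroSMulDivisors hγ
  haveI : Nontrivial I.H := ⟨⟨z, 0, hz0⟩⟩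
  intro hmem
  letI : _root_.Module ℤ_[7] (I.H ⧸ (IwasawaAlgebra 7) ∙ z) :=
    Module.compHom _ (algebraMap ℤ_[7] (IwasawaAlgebra 7))
  haveI : IsScalarTower ℤ_[7] (IwasawaAlgebra 7) (I.H ⧸ (IwasawaAlgebra 7) ∙ z) :=
    IsScalarTower.of_compHom ℤ_[7] _ _
  have hfin : Module.Finite ℤ_[7] (I.H ⧸ (IwasawaAlgebra 7) ∙ z) :=
    finite_of_lengthAt_eq_zero 7 (I.H ⧸ (IwasawaAlgebra 7) ∙ z) 𝔮 h7 h
  exact not_moduleFinite_quotient_span_of_mem_augIdealP_smul_top (p := 7) hmem hfin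

/-- **On `𝒞₇`, granted GZK, for every NON-ZERO class `z ∈ 𝐇¹`: `length_{(7)}(𝐇¹ ⧸ Λz) = 0 ⟺ z ∉ 7·𝐇¹`** — the
pointwise dictionary behind `2b′ ⟺ K2`. [cite: Kato2004Asterisque, Thm. 12.4 (2)(3) (p. 221)] [cite: Washington1997, §13.2] -/
theorem lengthAt_seven_quotient_span_eq_zero_iff_not_mem (hGZK : rank_eq_analyticRank_of_analyticRank_le_one)
    (W : WeierstrassCurve ℚ) [W.IsElliptic] [W.IsGloballyMinimal] [Fact (Nat.Prime 7)] (hC : X12.ClassCSeven W)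
    [ContinuousSMul ℤ_[7] (W.tateModule 7)] {K : ZpExtension ℚ 7} (hK : K.IsCyclotomic)
    {γ : Field.absoluteGaloisGroup ℚ} (hγ : K.IsTopGenerator γ) (I : IwasawaH1Data W 7 K γ) {z : I.H} (hz0 : z ≠ 0)
    (𝔮 : PrimeSpectrum (IwasawaAlgebra 7)) (h7 : 𝔮.asIdeal = IwasawaAlgebra.augIdealP 7) :
    Module.lengthAt (IwasawaAlgebra 7) (I.H ⧸ (IwasawaAlgebra 7) ∙ z) 𝔮 = 0 ↔
      z ∉ (IwasawaAlgebra.augIdealP 7 • (⊤ : Submodule (IwasawaAlgebra 7) I.H)) :=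
  ⟨not_mem_seven_smul_top_of_lengthAt_quotient_span_eq_zero W hK hγ I hz0 𝔮 h7,
    fun hz ↦ lengthAt_seven_quotient_span_eq_zero_of_not_mem hGZK W hC hK hγ I hz 𝔮 h7⟩

/-- **K3 PAID — on `𝒞₇`, granted GZK, `ResidualNonvanishingSeven ⟹ KatoPrimitiveSeven`** (the pointwise core at the
admissible class; GZK is the crux's own antecedent). [cite: Kato2004Asterisque, Thm. 12.4 (2)(3) (p. 221), §13.8 (pp. 228–229)]
[cite: Washington1997, §7.1 Thm. 7.3, §13.2] -/
theorem katoPrimitiveSeven_of_residualNonvanishing (hGZK : rank_eq_analyticRank_of_analyticRank_le_one)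
    (hK2 : ResidualNonvanishingSeven) : KatoPrimitiveSeven := by
  intro W _ _ _ hC K hK γ hγ I z₀ hz₀ 𝔮 _h𝔮 h7
  haveI : ContinuousSMul ℤ_[7] (W.tateModule 7) := TateModule.continuousSMul_padicInt
  exact lengthAt_seven_quotient_span_eq_zero_of_not_mem hGZK W hC hK hγ I (hK2 W hC K hK γ hγ I z₀ hz₀) 𝔮 h7

/-- … and conversely **`KatoPrimitiveSeven ⟹ ResidualNonvanishingSeven` at every NON-ZERO admissible class**, with no
hypothesis at all (the vanishing class is the only place where 2b′, vacuously about `𝐇¹ ⧸ 0 = 𝐇¹` when `𝐇¹ = 0`, and K2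
can differ). [cite: Washington1997, §13.2] [cite: Kato2004Asterisque, Thm. 12.4 (2) (p. 221)] -/
theorem residualNonvanishing_of_katoPrimitiveSeven_of_ne_zero (hprim : KatoPrimitiveSeven) :
    ∀ (W : WeierstrassCurve ℚ) [W.IsElliptic] [W.IsGloballyMinimal] [Fact (Nat.Prime 7)], X12.ClassCSeven W →
      letI : ContinuousSMul ℤ_[7] (W.tateModule 7) := TateModule.continuousSMul_padicInt
      ∀ (K : ZpExtension ℚ 7) (hK : K.IsCyclotomic) (γ : Field.absoluteGaloisGroup ℚ) (_ : K.IsTopGenerator γ)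
        (I : IwasawaH1Data W 7 K γ) (z₀ : I.H), Kato2004.IsAdmissibleZetaClass W 7 K hK I z₀ → z₀ ≠ 0 →
        z₀ ∉ (IwasawaAlgebra.augIdealP 7 • (⊤ : Submodule (IwasawaAlgebra 7) I.H)) := by
  intro W _ _ _ hC K hK γ hγ I z₀ hz₀ hne
  haveI : ContinuousSMul ℤ_[7] (W.tateModule 7) := TateModule.continuousSMul_padicInt
  have hprime : (IwasawaAlgebra.augIdealP 7).IsPrime := IwasawaAlgebra.isPrime_augIdealP_holds 7
  have hht : (IwasawaAlgebra.augIdealP 7).height = 1 := IwasawaAlgebra.height_augIdealP_holds 7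
  exact not_mem_seven_smul_top_of_lengthAt_quotient_span_eq_zero W hK hγ I hne ⟨IwasawaAlgebra.augIdealP 7, hprime⟩ rfl
    (hprim W hC K hK γ hγ I z₀ hz₀ ⟨IwasawaAlgebra.augIdealP 7, hprime⟩ hht rfl)

/-- **STUB 2b VERBATIM ⟸ {char-form `μ = 0`, Ferrero–Washington, GZK} ∧ `ResidualNonvanishingSeven`** (REV 1's
`stubKatoMuEqualitySeven_of` with P1 and K3 discharged): the type below is letter-for-letter the type of
`KatoPerrinRiouZp.stub_katoMuEqualitySeven` (line of record v9, l. 229–237).  The one research input is K2.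
CONDITIONAL; nothing asserted; 19945 stays OPEN. [cite: Kato2004Asterisque, Conj. 12.10 (p. 224), Thm. 12.4 (2)(3) (p. 221)]
[cite: CoatesSujatha2005, Cor. 3.6] [cite: BurungaleTian2026, Rem. 2.7 (p. 5)] -/
theorem stubKatoMuEqualitySeven_of_residualNonvanishing
    (hchar : classicalMuVanishes_finite_unramifiedClasses) (hFW : ferreroWashington1979_classicalMuVanishes)
    (hGZK : rank_eq_analyticRank_of_analyticRank_le_one) (hK2 : ResidualNonvanishingSeven) :
    ∀ (W : WeierstrassCurve ℚ) [W.IsElliptic] [W.IsGloballyMinimal] [Fact (Nat.Prime 7)], X12.ClassCSeven W →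
      letI : ContinuousSMul ℤ_[7] (W.tateModule 7) := TateModule.continuousSMul_padicInt
      ∀ (K : ZpExtension ℚ 7) (hK : K.IsCyclotomic) (γ : Field.absoluteGaloisGroup ℚ) (_ : K.IsTopGenerator γ)
        (I : IwasawaH1Data W 7 K γ) (z₀ : I.H), Kato2004.IsAdmissibleZetaClass W 7 K hK I z₀ →
        ∀ (Y : W.FineSelmerDualData K γ⁻¹) (𝔮 : PrimeSpectrum (IwasawaAlgebra 7)), 𝔮.asIdeal.height = 1 →
          𝔮.asIdeal = IwasawaAlgebra.augIdealP 7 →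
          Module.lengthAt (IwasawaAlgebra 7) Y.X 𝔮 =
            Module.lengthAt (IwasawaAlgebra 7) (I.H ⧸ (IwasawaAlgebra 7) ∙ z₀) 𝔮 :=
  stubKatoMuEqualitySeven_of hchar hFW fineDualFGSeven_holds (katoPrimitiveSeven_of_residualNonvanishing hGZK hK2)

end Summit.BirchSwinnertonDyer.BirchSwinnertonDyer.Cruxes.EllipticUnitValueSevenOfGZK.KatoMuAbelianResidue

end
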